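import Summits.HubbardSuperconductivity.HubbardSuperconductivity.Theses.AnisotropyChord

/-!
# Route `AnisotropyChord`: the range-split glue `FerroSideChordOfPieces` (stmt-HubbardSuperconductivity-23921)

Pure logic (tenure split D1, director-hubbard 2026-08-30; planner hubbard-anisotropy-tenure-1 g0): piece A (`FerroSideChordLarge`,
even `M ≥ 9`, `Δ ∈ (0,1)`) and residual B (`FerroSideChordSmall`, `M ≤ 8`, `Δ ∈ (0,1)`) give the interior statement for every even
`M ≥ 4` by a case split on `M ≤ 8`; residual C (`FerroSideChordEndpoints`) turns the interior statement into the endpoints `Δ ∈ {0,1}`;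
together they give `FerroSideChord` on `Δ ∈ [0,1]`.  Prover seat `hubbard-h0-rotor-p1` g26 (`--workitem stmt-HubbardSuperconductivity-23921`).
WHAT THIS IS NOT: nothing here proves superconductivity in the Hubbard model, nor any of the three pieces; it is the bookkeeping glue only.
Route-file import only; no sorry, no axioms.
-/

set_option linter.dupNamespace false

namespace Summit.HubbardSuperconductivity.HubbardSuperconductivity.Theorems

open Summit.HubbardSuperconductivity.HubbardSuperconductivity.Theses.AnisotropyChord in
/-- ★ the glue: `FerroSideChordLarge → FerroSideChordSmall → FerroSideChordEndpoints → FerroSideChord`. [folklore] -/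
theorem ferroSideChordOfPieces_proof :
    Summit.HubbardSuperconductivity.HubbardSuperconductivity.Theses.AnisotropyChord.FerroSideChordOfPieces := by
  intro hA hB hC M inst hEven h4 Δ hΔ ψ hψ hnorm heig
  -- the interior statement `Δ ∈ (0,1)` for this `M`, by the case split `M ≤ 8` / `9 ≤ M`
  have hint : ∀ Δ' ∈ Set.Ioo (0:ℝ) 1,
      ∀ (ψ' : Literature.MathematicalPhysics.QuantumLattice.TensorIndex
        (Literature.Probability.LatticeModels.TorusSite 2 M) 2 → ℂ),
      ψ' ∈ Literature.MathematicalPhysics.QuantumLattice.spinZSector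
        (Λ := Literature.Probability.LatticeModels.TorusSite 2 M) 1 0 →
      star ψ' ⬝ᵥ ψ' = 1 →
      Matrix.mulVec (Literature.MathematicalPhysics.QuantumLattice.xxzHamiltonian 1
        (Literature.Probability.LatticeModels.torusGraph 2 M) (-1) Δ') ψ'
        = ((Literature.MathematicalPhysics.QuantumLattice.lowestEnergyInSector 1
            (Literature.MathematicalPhysics.QuantumLattice.xxzHamiltonian 1
              (Literature.Probability.LatticeModels.torusGraph 2 M) (-1) Δ') 0 : ℝ) : ℂ) • ψ' →
      (1 + Δ') / 2 * ((M : ℝ) ^ 2 / 2 * ((M : ℝ) ^ 2 / 2 + 1))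
        ≤ (star ψ' ⬝ᵥ Matrix.mulVec
            ((∑ x : Literature.Probability.LatticeModels.TorusSite 2 M,
                Literature.MathematicalPhysics.QuantumLattice.onSite x
                  (Literature.MathematicalPhysics.QuantumLattice.spinRaise 1)) *
              (∑ y : Literature.Probability.LatticeModels.TorusSite 2 M,
                Literature.MathematicalPhysics.QuantumLattice.onSite y
                  (Literature.MathematicalPhysics.QuantumLattice.spinLower 1))) ψ').re := by
    intro Δ' hΔ' ψ' hψ' hn' he'
    by_cases hM : M ≤ 8
    · exact hB M hEven h4 hM Δ' hΔ' ψ' hψ' hn' he'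
    · exact hA M hEven (by omega) Δ' hΔ' ψ' hψ' hn' he'
  rcases hΔ with ⟨h0, h1⟩
  by_cases hends : Δ = 0 ∨ Δ = 1
  · exact hC M hEven h4 hint Δ hends ψ hψ hnorm heig
  · obtain ⟨hne0, hne1⟩ := not_or.mp hends
    exact hint Δ ⟨lt_of_le_of_ne h0 (Ne.symm hne0), lt_of_le_of_ne h1 hne1⟩ ψ hψ hnorm heig

end Summit.HubbardSuperconductivity.HubbardSuperconductivity.Theorems
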